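import Summits.BirchSwinnertonDyer.BirchSwinnertonDyer.Theorems.KolyvaginRoadThreeZhangInductionOnPos
import Summits.BirchSwinnertonDyer.BirchSwinnertonDyer.Theorems.KolyvaginRoadThreeMethod2ParityRank
import Literature.NumberTheory.EllipticCurves.HeegnerPointsOfConductor
import HarnessLib

/-!
# Route `KolyvaginRoadThree`, deciding crux `ZhangSharpFrameAtThreeHL` (item stmt-BirchSwinnertonDyer-19574):
# what the registered stub `Method2.stub_kolyvaginClassesAtThree` pins ABOVE the bottom level — nothing
# (cell `bsd-stepL`, ACCEL seat `bsd-stepL-koly3b` g2; `--supports stmt-BirchSwinnertonDyer-19574`, helper; a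
# signature-truth probe of stub B of the METHOD skeleton v2u ∕ v2w ∕ v2x, owner `bsd-stepL-koly`)

HONEST FRAMING. 0 defs, 0 facts, 0 `sorry`; nothing about Heegner points of level-raised forms is asserted or used.
Every hypothesis below is a frame-wise SHAPE: (CRUX@frame) = the conclusion of the crux `ZhangSharpFrameAtThreeHL` at
the frame; (PAR) = odd total canonical rank at good even levels (= (FLIP) + the registered parity stub
`stub_oddSelmerRankAtThree`, tree `odd_selQRank_on_goodLevel_of_flip_of_odd`); (COV) = a family of classes in
`H¹(K, E[3])`, indexed by the frame's Kolyvagin data, whose localisations cover the unipotent-admissible primes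
(Poitou–Tate supply + the infinitude of the index type — see below); (A3)@∅ = the bottom instance of the stub's own
triangulation conjunct. PARTITION: O2@3 (B10) × A1 × crux 19574 — none (probe + helper; types nothing, closes nothing;
T7).

THE FINDING. Stub B (`stub_kolyvaginClassesAtThree`, text unchanged since v2s: REALISATION ∧ (A2) ∧ (A3) ∧ (A5)) asks for
classes `κ m n ∈ H¹(K, E[3])` at every finite set `n` of unipotent-admissible primes, PINNED at `n = ∅` to the concrete
Kolyvagin classes and FREE at `n ≠ ∅` — W. Zhang's `c(m, n)` on `X_{N⁺, N⁻∏n}` are the intended values, but the tree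
has no level-raised form, so nothing in the signature refers to them. The card's junk test («B is a FUNCTION of κ, so
(A2) cannot be vacated by B ≡ ∅») misses that ABOVE the bottom the base locus `baseLocusQ κ n` is a function of the FREE
values only, and that the index type `M` of Kolyvagin data is infinite (its fields `σ`, `S`, `emb` vary freely off the
support), so a COVERING family `j : M → H¹(K, E[3])` (for every u-admissible `q` some `j m` has non-zero localisation at
`q`) makes `baseLocusQ κ n = ∅` at every `n ≠ ∅`. With `κ m ∅ := c(m)` and `κ m n := j m` (made nowhere zero) for
`n ≠ ∅`, and `m₁ :=` THE CRUX'S OWN WITNESS at the frame: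
* (A2) holds at every level: its conclusion `∃ m, κ m n ≠ 0` is the crux witness at `n = ∅` and junk above;
* (A5) holds at every level for the same reason (the rank-one hypothesis is never read);
* (A3) above the bottom reduces, the base locus being empty (`SelRel n ∅ = Sel n`), to «the two eigen-dimensions of
  `Sel_n` differ», i.e. to the PARITY of the total rank — and at the parity-coherent good levels of v2x's `_of`
  (`Good n := GoodLevel n ∧ (Odd (rank n) ↔ Even #n)`) to nothing at all;
* (A3) AT the bottom is a genuine statement (Lemma 8.4 (1)+(3) at `p = 3` for the concrete mod-3 Kolyvagin system of
  `E/K`, base locus read on u-admissible primes) — but the engine never instantiates (A3) at `∅`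
  (`ZhangInductionOnPos.exists_ne_zero_of_zhangInduction_on_pos`, this seat): it is IDLE.
THEOREMS: `stubB_consumed_of_cruxAt_of_cover` (for ANY level predicate `Good` whose non-empty even levels have odd total
rank: REALISATION ∧ (A2) ∧ (A3 at non-empty levels) ∧ (A5) ⟸ CRUX@frame ∧ COV), its parity-coherent instance
`stubB_consumedCoherent_of_cruxAt_of_cover` (⟸ CRUX@frame ∧ COV, no parity input), and the registered body
`stubB_body_of_cruxAt_of_oddRank_of_cover_of_bottom` (⟸ CRUX@frame ∧ PAR ∧ COV ∧ (A3)@∅). (The converse bookkeeping —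
CRUX@frame ⟸ (A1) ∧ odd bottom rank ∧ the consumed part, v2x's `_of` on the engine variant — is the companion file
`KolyvaginRoadThreeMethod2ConsumedClassesCircle.lean`.) CONSEQUENCE for the line: given stubs A and P, the consumed
part of stub B is EQUIVALENT, modulo the covering family, to the crux's conclusion at the frame; none of Zhang Thm. 4.3,
Lemma 8.4 or Thm. 7.2 for LEVEL-RAISED forms is pinned by the registered text. Repairs are the owner's ∕ planner's call
(memo `koly3b/STUB-B-ABOVE-BOTTOM-19574.md`).

References: [cite: WZhang2014, §9 proof of Thm. 9.1 (pp. 240–241), Def. 8.3, Lemma 8.4, Thm. 4.3, Thm. 7.2]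
[cite: GrossLMS1991, §3–§4 (Kolyvagin data)]. -/

noncomputable section

open scoped Classical
namespace Summit.BirchSwinnertonDyer.Rank1Residual.X11b.Three.Koly.Method2

open WeierstrassCurve NumberField IsDedekindDomain
  Literature.NumberTheory.EllipticCurves Literature.NumberTheory.EllipticCurves.ModularForms
  Literature.NumberTheory.GaloisRepresentations Module

variable (W : WeierstrassCurve ℚ) (K : Type) [Field K] [NumberField K] [W.IsGloballyMinimal] (c : K ≃ₐ[ℚ] K)

/-! ## §1 The base locus of a level depends only on the classes AT that level; a covering family empties it -/

/-- The base locus at level `n` depends only on the classes `κ · n` at that level. [cite: WZhang2014, Definition 8.3] -/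
theorem baseLocusQ_congr {M : Type} (κ κ' : M → Finset {q // IsUAdmissiblePrime W K q} → V3 W K)
    (n : Finset {q // IsUAdmissiblePrime W K q}) (h : ∀ m, κ m n = κ' m n) :
    baseLocusQ W K κ n = baseLocusQ W K κ' n := by
  ext q
  simp only [baseLocusQ, Set.mem_setOf_eq, h]

/-- **A covering family has EMPTY base locus**: if for every unipotent-admissible `q` some class `κ m n` has non-zero
localisation at a place above `q`, then no `q` is a base point of `κ · n`. [cite: WZhang2014, Definition 8.3] -/
theorem baseLocusQ_eq_empty_of_cover {M : Type} (κ : M → Finset {q // IsUAdmissiblePrime W K q} → V3 W K)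
    (n : Finset {q // IsUAdmissiblePrime W K q})
    (hcov : ∀ q : {q // IsUAdmissiblePrime W K q}, ∃ m, ∃ v : HeightOneSpectrum (𝓞 K),
      ((q : ℕ) : 𝓞 K) ∈ v.asIdeal ∧
        κ m n ∉ (W.baseChange K).torsionLocalKer (v.adicCompletion K) ((3 ^ 1 : ℕ) : ℤ)) :
    baseLocusQ W K κ n = ∅ := by
  ext q
  simp only [baseLocusQ, Set.mem_setOf_eq, Set.mem_empty_iff_false, iff_false]
  intro hq
  obtain ⟨m, v, hv, hm⟩ := hcov q
  exact hm (hq m v hv)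

/-- **With empty base locus, (A3) IS parity**: if `baseLocusQ κ n = ∅` and the total canonical rank at `n` is odd, the
triangulation conjunct of `stub_kolyvaginClassesAtThree` holds at `n` (take `s` = the larger eigenspace,
`d = dim Sel_n^s − 1`; the relaxed spaces are the un-relaxed ones, finite-dimensional by `finiteDimensional_selQ`).
[cite: WZhang2014, Lemma 8.4 (1)+(3)] -/
theorem triangulation_of_odd_of_baseLocusQ_eq_empty [W.IsElliptic] [Module (ZMod 3) (V3 W K)] {M : Type}
    (κ : M → Finset {q // IsUAdmissiblePrime W K q} → V3 W K) (n : Finset {q // IsUAdmissiblePrime W K q})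
    (hB : baseLocusQ W K κ n = ∅)
    (hodd : Odd (finrank (ZMod 3) (SelQ W K c n true) + finrank (ZMod 3) (SelQ W K c n false))) :
    ∃ (s : Bool) (d : ℕ), finrank (ZMod 3) (SelQ W K c n s) = d + 1 ∧
      SelQ W K c n s = SelRelQ W K c n (baseLocusQ W K κ n) s ∧
      FiniteDimensional (ZMod 3) (SelRelQ W K c n (baseLocusQ W K κ n) (!s)) ∧
      finrank (ZMod 3) (SelRelQ W K c n (baseLocusQ W K κ n) (!s)) ≤ d := by
  rw [hB]
  have hne : finrank (ZMod 3) (SelQ W K c n true) ≠ finrank (ZMod 3) (SelQ W K c n false) := by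
    intro h
    rw [h] at hodd
    exact Nat.not_even_iff_odd.mpr hodd ⟨_, rfl⟩
  by_cases hlt : finrank (ZMod 3) (SelQ W K c n false) < finrank (ZMod 3) (SelQ W K c n true)
  · refine ⟨true, finrank (ZMod 3) (SelQ W K c n true) - 1, by omega, selQ_eq_selRelQ_empty W K c n true, ?_, ?_⟩
    · rw [Bool.not_true, ← selQ_eq_selRelQ_empty]
      exact finiteDimensional_selQ W K c n false
    · rw [Bool.not_true, ← selQ_eq_selRelQ_empty]
      omega
  · refine ⟨false, finrank (ZMod 3) (SelQ W K c n false) - 1, by omega, selQ_eq_selRelQ_empty W K c n false, ?_, ?_⟩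
    · rw [Bool.not_false, ← selQ_eq_selRelQ_empty]
      exact finiteDimensional_selQ W K c n true
    · rw [Bool.not_false, ← selQ_eq_selRelQ_empty]
      omega

/-! ## §2 The consumed part of stub B from the crux's own conclusion at the frame and a covering family -/

/-- **The part of `stub_kolyvaginClassesAtThree` that the composition consumes, FROM THE CRUX AT THE FRAME + A COVERING
FAMILY.** For ANY predicate `Good` on levels such that the total canonical rank is odd at every NON-EMPTY good level of
even cardinality: if (CRUX@frame) some concrete Kolyvagin class `c(m) ∈ H¹(K, E[3])` of the frame is non-zero, and (COV)
there is a family `j : M → H¹(K, E[3])` (`M` = the frame's Kolyvagin-supported Kolyvagin–Heegner data) whose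
localisations cover the unipotent-admissible primes, then there are `κ`, `m₁` with the REALISATION identity, (A2) on good
levels, (A3) at NON-EMPTY good even levels, and (A5) on good levels — verbatim the stub's conjuncts relativised to `Good`,
(A3) restricted to `n.Nonempty`. Construction: `κ m ∅ := c(m)`, `κ m n := j m` (patched to be nowhere zero) for
`n ≠ ∅`, `m₁ :=` the crux witness; (A2) and (A5) then hold at every level outright, and (A3) above the bottom is parity
(`triangulation_of_odd_of_baseLocusQ_eq_empty`). No level-raised form, no congruence, no base case is used.
[cite: WZhang2014, §9 proof of Thm. 9.1] -/
theorem stubB_consumed_of_cruxAt_of_cover [W.IsElliptic] [NeZero (W.conductorNorm ℤ)] [Module (ZMod 3) (V3 W K)]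
    (Dt : ModularParametrizationData W (W.conductorNorm ℤ)) (β : ℤ) (ι : K →+* ℂ)
    (Good : Finset {q // IsUAdmissiblePrime W K q} → Prop)
    (hGood : ∀ (n : Finset {q // IsUAdmissiblePrime W K q}), Good n → n.Nonempty → Even n.card →
      Odd (finrank (ZMod 3) (SelQ W K c n true) + finrank (ZMod 3) (SelQ W K c n false)))
    -- (CRUX@frame) the conclusion of `ZhangSharpFrameAtThreeHL` at this frame
    (hcrux : ∃ (n : ℕ) (d : KolyvaginHeegnerData Dt β ι n),
      KolyvaginDescent.KolSupp (Zhang2014.IsKolyvaginPrime (W.conductorNorm ℤ) W K 3) n ∧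
        d.kolyvaginClass Nat.prime_three 1 ≠ 0)
    -- (COV) a covering family indexed by the frame's Kolyvagin data
    (hcov : ∃ j : {x : (n : ℕ) × KolyvaginHeegnerData Dt β ι n //
          KolyvaginDescent.KolSupp (Zhang2014.IsKolyvaginPrime (W.conductorNorm ℤ) W K 3) x.1} → V3 W K,
      ∀ q : {q // IsUAdmissiblePrime W K q}, ∃ m, ∃ v : HeightOneSpectrum (𝓞 K), ((q : ℕ) : 𝓞 K) ∈ v.asIdeal ∧
        j m ∉ (W.baseChange K).torsionLocalKer (v.adicCompletion K) ((3 ^ 1 : ℕ) : ℤ)) :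
    ∃ (κ : {x : (n : ℕ) × KolyvaginHeegnerData Dt β ι n //
            KolyvaginDescent.KolSupp (Zhang2014.IsKolyvaginPrime (W.conductorNorm ℤ) W K 3) x.1} →
          Finset {q // IsUAdmissiblePrime W K q} → V3 W K)
      (m₁ : {x : (n : ℕ) × KolyvaginHeegnerData Dt β ι n //
            KolyvaginDescent.KolSupp (Zhang2014.IsKolyvaginPrime (W.conductorNorm ℤ) W K 3) x.1}),
      -- REALISATION (identity in H¹(K, E[3]))
      (∀ m, κ m ∅ = m.1.2.kolyvaginClass Nat.prime_three 1) ∧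
      -- (A2) on good levels
      (∀ (n : Finset {q // IsUAdmissiblePrime W K q}) (q₁ q₂ : {q // IsUAdmissiblePrime W K q}),
        Good n → Good (insert q₁ n) → Good (insert q₂ (insert q₁ n)) →
        q₁ ∉ n → q₂ ∉ insert q₁ n → q₂ ∉ baseLocusQ W K κ (insert q₂ (insert q₁ n)) → ∃ m, κ m n ≠ 0) ∧
      -- (A3) at NON-EMPTY good even levels carrying a non-zero class
      (∀ (n : Finset {q // IsUAdmissiblePrime W K q}), Good n → n.Nonempty → Even n.card → (∃ m, κ m n ≠ 0) →
        ∃ (s : Bool) (d : ℕ), finrank (ZMod 3) (SelQ W K c n s) = d + 1 ∧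
          SelQ W K c n s = SelRelQ W K c n (baseLocusQ W K κ n) s ∧
          FiniteDimensional (ZMod 3) (SelRelQ W K c n (baseLocusQ W K κ n) (!s)) ∧
          finrank (ZMod 3) (SelRelQ W K c n (baseLocusQ W K κ n) (!s)) ≤ d) ∧
      -- (A5) on good levels
      (∀ (n : Finset {q // IsUAdmissiblePrime W K q}), Good n → Even n.card →
        finrank (ZMod 3) (SelQ W K c n true) + finrank (ZMod 3) (SelQ W K c n false) = 1 → κ m₁ n ≠ 0) := by
  obtain ⟨n₀, d₀, hk₀, hne₀⟩ := hcrux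
  obtain ⟨j, hj⟩ := hcov
  -- the crux witness as an index, and the junk family made nowhere zero
  let mstar : {x : (n : ℕ) × KolyvaginHeegnerData Dt β ι n //
      KolyvaginDescent.KolSupp (Zhang2014.IsKolyvaginPrime (W.conductorNorm ℤ) W K 3) x.1} := ⟨⟨n₀, d₀⟩, hk₀⟩
  let junk : {x : (n : ℕ) × KolyvaginHeegnerData Dt β ι n //
      KolyvaginDescent.KolSupp (Zhang2014.IsKolyvaginPrime (W.conductorNorm ℤ) W K 3) x.1} → V3 W K :=
    fun m ↦ if j m = 0 then d₀.kolyvaginClass Nat.prime_three 1 else j m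
  have hjunk_ne : ∀ m, junk m ≠ 0 := by
    intro m
    by_cases h : j m = 0
    · simp only [junk, if_pos h]
      exact hne₀
    · simp only [junk, if_neg h]
      exact h
  have hjunk_cov : ∀ q : {q // IsUAdmissiblePrime W K q}, ∃ m, ∃ v : HeightOneSpectrum (𝓞 K),
      ((q : ℕ) : 𝓞 K) ∈ v.asIdeal ∧
        junk m ∉ (W.baseChange K).torsionLocalKer (v.adicCompletion K) ((3 ^ 1 : ℕ) : ℤ) := by
    intro q
    obtain ⟨m, v, hv, hm⟩ := hj q
    have hjm : j m ≠ 0 := by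
      intro h
      apply hm
      rw [h]
      exact zero_mem _
    refine ⟨m, v, hv, ?_⟩
    simp only [junk, if_neg hjm]
    exact hm
  -- the system: the concrete classes at the bottom, junk above it
  let κ : {x : (n : ℕ) × KolyvaginHeegnerData Dt β ι n //
      KolyvaginDescent.KolSupp (Zhang2014.IsKolyvaginPrime (W.conductorNorm ℤ) W K 3) x.1} →
        Finset {q // IsUAdmissiblePrime W K q} → V3 W K :=
    fun m n ↦ if n = ∅ then m.1.2.kolyvaginClass Nat.prime_three 1 else junk m
  have hκ0 : ∀ m, κ m ∅ = m.1.2.kolyvaginClass Nat.prime_three 1 := fun m ↦ if_pos rfl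
  have hκ1 : ∀ m (n : Finset {q // IsUAdmissiblePrime W K q}), n ≠ ∅ → κ m n = junk m :=
    fun m n hn ↦ if_neg hn
  have hB1 : ∀ (n : Finset {q // IsUAdmissiblePrime W K q}), n ≠ ∅ → baseLocusQ W K κ n = ∅ := by
    intro n hn
    refine baseLocusQ_eq_empty_of_cover W K κ n fun q ↦ ?_
    obtain ⟨m, v, hv, hm⟩ := hjunk_cov q
    exact ⟨m, v, hv, by rw [hκ1 m n hn]; exact hm⟩
  have hstar : ∀ (n : Finset {q // IsUAdmissiblePrime W K q}), κ mstar n ≠ 0 := by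
    intro n
    by_cases hn : n = ∅
    · subst hn
      rw [hκ0]
      exact hne₀
    · rw [hκ1 mstar n hn]
      exact hjunk_ne mstar
  refine ⟨κ, mstar, hκ0, ?_, ?_, ?_⟩
  · -- (A2): the conclusion holds at EVERY level (the crux witness at ∅, junk above); the base locus is never read
    intro n _ _ _ _ _ _ _ _
    exact ⟨mstar, hstar n⟩
  · -- (A3) above the bottom: empty base locus + parity
    intro n hg hne hev _
    exact triangulation_of_odd_of_baseLocusQ_eq_empty W K c κ n (hB1 n (Finset.nonempty_iff_ne_empty.mp hne))
      (hGood n hg hne hev)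
  · -- (A5): the rank-one hypothesis is never read
    intro n _ _ _
    exact hstar n

/-- **The parity-coherent instance (the levels v2x's `_of` runs on): NO parity input.** With
`Good n := GoodLevel W K n ∧ (Odd (total canonical rank at n) ↔ Even #n)` — the predicate of the composition
`Method2.ZhangSharpFrameAtThreeHL_of` (v2w ∕ v2x) — the consumed part of stub B follows from (CRUX@frame) and (COV)
alone. [cite: WZhang2014, §9 proof of Thm. 9.1] -/
theorem stubB_consumedCoherent_of_cruxAt_of_cover [W.IsElliptic] [NeZero (W.conductorNorm ℤ)]
    [Module (ZMod 3) (V3 W K)]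
    (Dt : ModularParametrizationData W (W.conductorNorm ℤ)) (β : ℤ) (ι : K →+* ℂ)
    (hcrux : ∃ (n : ℕ) (d : KolyvaginHeegnerData Dt β ι n),
      KolyvaginDescent.KolSupp (Zhang2014.IsKolyvaginPrime (W.conductorNorm ℤ) W K 3) n ∧
        d.kolyvaginClass Nat.prime_three 1 ≠ 0)
    (hcov : ∃ j : {x : (n : ℕ) × KolyvaginHeegnerData Dt β ι n //
          KolyvaginDescent.KolSupp (Zhang2014.IsKolyvaginPrime (W.conductorNorm ℤ) W K 3) x.1} → V3 W K,
      ∀ q : {q // IsUAdmissiblePrime W K q}, ∃ m, ∃ v : HeightOneSpectrum (𝓞 K), ((q : ℕ) : 𝓞 K) ∈ v.asIdeal ∧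
        j m ∉ (W.baseChange K).torsionLocalKer (v.adicCompletion K) ((3 ^ 1 : ℕ) : ℤ)) :
    ∃ (κ : {x : (n : ℕ) × KolyvaginHeegnerData Dt β ι n //
            KolyvaginDescent.KolSupp (Zhang2014.IsKolyvaginPrime (W.conductorNorm ℤ) W K 3) x.1} →
          Finset {q // IsUAdmissiblePrime W K q} → V3 W K)
      (m₁ : {x : (n : ℕ) × KolyvaginHeegnerData Dt β ι n //
            KolyvaginDescent.KolSupp (Zhang2014.IsKolyvaginPrime (W.conductorNorm ℤ) W K 3) x.1}),
      (∀ m, κ m ∅ = m.1.2.kolyvaginClass Nat.prime_three 1) ∧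
      (∀ (n : Finset {q // IsUAdmissiblePrime W K q}) (q₁ q₂ : {q // IsUAdmissiblePrime W K q}),
        (GoodLevel W K n ∧ (Odd (finrank (ZMod 3) (SelQ W K c n true) + finrank (ZMod 3) (SelQ W K c n false)) ↔
          Even n.card)) →
        (GoodLevel W K (insert q₁ n) ∧ (Odd (finrank (ZMod 3) (SelQ W K c (insert q₁ n) true) +
          finrank (ZMod 3) (SelQ W K c (insert q₁ n) false)) ↔ Even (insert q₁ n).card)) →
        (GoodLevel W K (insert q₂ (insert q₁ n)) ∧
          (Odd (finrank (ZMod 3) (SelQ W K c (insert q₂ (insert q₁ n)) true) +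
            finrank (ZMod 3) (SelQ W K c (insert q₂ (insert q₁ n)) false)) ↔ Even (insert q₂ (insert q₁ n)).card)) →
        q₁ ∉ n → q₂ ∉ insert q₁ n → q₂ ∉ baseLocusQ W K κ (insert q₂ (insert q₁ n)) → ∃ m, κ m n ≠ 0) ∧
      (∀ (n : Finset {q // IsUAdmissiblePrime W K q}),
        (GoodLevel W K n ∧ (Odd (finrank (ZMod 3) (SelQ W K c n true) + finrank (ZMod 3) (SelQ W K c n false)) ↔
          Even n.card)) → n.Nonempty → Even n.card → (∃ m, κ m n ≠ 0) →
        ∃ (s : Bool) (d : ℕ), finrank (ZMod 3) (SelQ W K c n s) = d + 1 ∧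
          SelQ W K c n s = SelRelQ W K c n (baseLocusQ W K κ n) s ∧
          FiniteDimensional (ZMod 3) (SelRelQ W K c n (baseLocusQ W K κ n) (!s)) ∧
          finrank (ZMod 3) (SelRelQ W K c n (baseLocusQ W K κ n) (!s)) ≤ d) ∧
      (∀ (n : Finset {q // IsUAdmissiblePrime W K q}),
        (GoodLevel W K n ∧ (Odd (finrank (ZMod 3) (SelQ W K c n true) + finrank (ZMod 3) (SelQ W K c n false)) ↔
          Even n.card)) → Even n.card →
        finrank (ZMod 3) (SelQ W K c n true) + finrank (ZMod 3) (SelQ W K c n false) = 1 → κ m₁ n ≠ 0) :=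
  stubB_consumed_of_cruxAt_of_cover W K c Dt β ι
    (fun n ↦ GoodLevel W K n ∧
      (Odd (finrank (ZMod 3) (SelQ W K c n true) + finrank (ZMod 3) (SelQ W K c n false)) ↔ Even n.card))
    (fun _ hg _ hev ↦ hg.2.mpr hev) hcrux hcov

/-! ## §3 The registered body of stub B (v2u = v2w = v2x text) from CRUX@frame, parity, a covering family and (A3)@∅ -/

/-- **The body of the registered stub `stub_kolyvaginClassesAtThree` — REALISATION ∧ (A2) ∧ (A3) ∧ (A5) on `GoodLevel`
levels, verbatim — from four frame-wise shapes none of which mentions a level-raised form**: (CRUX@frame) the crux's own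
conclusion at the frame; (PAR) odd total canonical rank at every NON-EMPTY good even level [(FLIP) + 3-parity of
`Sel₃(E/K)`, tree `odd_selQRank_on_goodLevel_of_flip_of_odd`]; (COV) a covering family indexed by the Kolyvagin data;
(A3)@∅ the stub's own triangulation conjunct AT THE BOTTOM for the concrete classes (idle in `_of`, see
`ZhangInductionOnPos`). So above the bottom the stub pins nothing of Zhang Thm. 4.3 ∕ Lemma 8.4 ∕ Thm. 7.2.
[cite: WZhang2014, §9 proof of Thm. 9.1, Lemma 8.4, Thm. 4.3, Thm. 7.2] -/
theorem stubB_body_of_cruxAt_of_oddRank_of_cover_of_bottom [W.IsElliptic] [NeZero (W.conductorNorm ℤ)]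
    [Module (ZMod 3) (V3 W K)]
    (Dt : ModularParametrizationData W (W.conductorNorm ℤ)) (β : ℤ) (ι : K →+* ℂ)
    (hcrux : ∃ (n : ℕ) (d : KolyvaginHeegnerData Dt β ι n),
      KolyvaginDescent.KolSupp (Zhang2014.IsKolyvaginPrime (W.conductorNorm ℤ) W K 3) n ∧
        d.kolyvaginClass Nat.prime_three 1 ≠ 0)
    (hpar : ∀ (n : Finset {q // IsUAdmissiblePrime W K q}), GoodLevel W K n → n.Nonempty → Even n.card →
      Odd (finrank (ZMod 3) (SelQ W K c n true) + finrank (ZMod 3) (SelQ W K c n false)))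
    (hcov : ∃ j : {x : (n : ℕ) × KolyvaginHeegnerData Dt β ι n //
          KolyvaginDescent.KolSupp (Zhang2014.IsKolyvaginPrime (W.conductorNorm ℤ) W K 3) x.1} → V3 W K,
      ∀ q : {q // IsUAdmissiblePrime W K q}, ∃ m, ∃ v : HeightOneSpectrum (𝓞 K), ((q : ℕ) : 𝓞 K) ∈ v.asIdeal ∧
        j m ∉ (W.baseChange K).torsionLocalKer (v.adicCompletion K) ((3 ^ 1 : ℕ) : ℤ))
    (hbot : (∃ m : {x : (n : ℕ) × KolyvaginHeegnerData Dt β ι n //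
          KolyvaginDescent.KolSupp (Zhang2014.IsKolyvaginPrime (W.conductorNorm ℤ) W K 3) x.1},
        m.1.2.kolyvaginClass Nat.prime_three 1 ≠ 0) →
      ∃ (s : Bool) (d : ℕ), finrank (ZMod 3) (SelQ W K c ∅ s) = d + 1 ∧
        SelQ W K c ∅ s = SelRelQ W K c ∅ (baseLocusQ W K
          (fun (m : {x : (n : ℕ) × KolyvaginHeegnerData Dt β ι n //
              KolyvaginDescent.KolSupp (Zhang2014.IsKolyvaginPrime (W.conductorNorm ℤ) W K 3) x.1})
            (_ : Finset {q // IsUAdmissiblePrime W K q}) ↦ m.1.2.kolyvaginClass Nat.prime_three 1) ∅) s ∧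
        FiniteDimensional (ZMod 3) (SelRelQ W K c ∅ (baseLocusQ W K
          (fun (m : {x : (n : ℕ) × KolyvaginHeegnerData Dt β ι n //
              KolyvaginDescent.KolSupp (Zhang2014.IsKolyvaginPrime (W.conductorNorm ℤ) W K 3) x.1})
            (_ : Finset {q // IsUAdmissiblePrime W K q}) ↦ m.1.2.kolyvaginClass Nat.prime_three 1) ∅) (!s)) ∧
        finrank (ZMod 3) (SelRelQ W K c ∅ (baseLocusQ W K
          (fun (m : {x : (n : ℕ) × KolyvaginHeegnerData Dt β ι n //
              KolyvaginDescent.KolSupp (Zhang2014.IsKolyvaginPrime (W.conductorNorm ℤ) W K 3) x.1})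
            (_ : Finset {q // IsUAdmissiblePrime W K q}) ↦ m.1.2.kolyvaginClass Nat.prime_three 1) ∅) (!s)) ≤ d) :
    ∃ (κ : {x : (n : ℕ) × KolyvaginHeegnerData Dt β ι n //
            KolyvaginDescent.KolSupp (Zhang2014.IsKolyvaginPrime (W.conductorNorm ℤ) W K 3) x.1} →
          Finset {q // IsUAdmissiblePrime W K q} → V3 W K)
      (m₁ : {x : (n : ℕ) × KolyvaginHeegnerData Dt β ι n //
            KolyvaginDescent.KolSupp (Zhang2014.IsKolyvaginPrime (W.conductorNorm ℤ) W K 3) x.1}),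
      -- REALISATION (identity in H¹(K, E[3]))
      (∀ m, κ m ∅ = m.1.2.kolyvaginClass Nat.prime_three 1) ∧
      -- (A2) congruence transport along two good steps, base locus defined from κ
      (∀ (n : Finset {q // IsUAdmissiblePrime W K q}) (q₁ q₂ : {q // IsUAdmissiblePrime W K q}),
        GoodLevel W K n → GoodLevel W K (insert q₁ n) → GoodLevel W K (insert q₂ (insert q₁ n)) →
        q₁ ∉ n → q₂ ∉ insert q₁ n → q₂ ∉ baseLocusQ W K κ (insert q₂ (insert q₁ n)) → ∃ m, κ m n ≠ 0) ∧
      -- (A3) triangulation at a good even level carrying a non-zero class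
      (∀ (n : Finset {q // IsUAdmissiblePrime W K q}), GoodLevel W K n → Even n.card → (∃ m, κ m n ≠ 0) →
        ∃ (s : Bool) (d : ℕ), finrank (ZMod 3) (SelQ W K c n s) = d + 1 ∧
          SelQ W K c n s = SelRelQ W K c n (baseLocusQ W K κ n) s ∧
          FiniteDimensional (ZMod 3) (SelRelQ W K c n (baseLocusQ W K κ n) (!s)) ∧
          finrank (ZMod 3) (SelRelQ W K c n (baseLocusQ W K κ n) (!s)) ≤ d) ∧
      -- (A5) base case: canonical rank one at a good even level
      (∀ (n : Finset {q // IsUAdmissiblePrime W K q}), GoodLevel W K n → Even n.card →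
        finrank (ZMod 3) (SelQ W K c n true) + finrank (ZMod 3) (SelQ W K c n false) = 1 → κ m₁ n ≠ 0) := by
  obtain ⟨κ, m₁, hreal, hA2, hA3, hA5⟩ :=
    stubB_consumed_of_cruxAt_of_cover W K c Dt β ι (GoodLevel W K) hpar hcrux hcov
  have hB0 : baseLocusQ W K κ ∅ = baseLocusQ W K
      (fun (m : {x : (n : ℕ) × KolyvaginHeegnerData Dt β ι n //
          KolyvaginDescent.KolSupp (Zhang2014.IsKolyvaginPrime (W.conductorNorm ℤ) W K 3) x.1})
        (_ : Finset {q // IsUAdmissiblePrime W K q}) ↦ m.1.2.kolyvaginClass Nat.prime_three 1) ∅ :=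
    baseLocusQ_congr W K κ _ ∅ hreal
  refine ⟨κ, m₁, hreal, hA2, fun n hg hev hex ↦ ?_, hA5⟩
  by_cases hn : n = ∅
  · subst hn
    rw [hB0]
    obtain ⟨m, hm⟩ := hex
    exact hbot ⟨m, by rw [← hreal m]; exact hm⟩
  · exact hA3 n hg (Finset.nonempty_iff_ne_empty.mpr hn) hev hex

/-- **The same with (PAR) supplied by (FLIP) + the 3-parity of `Sel₃(E/K)`** (the registered parity stub
`stub_oddSelmerRankAtThree` of v2w ∕ v2x, through the tree's `odd_selQRank_on_goodLevel_of_flip_of_odd` and the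
eigen-dictionary `finrank_selmer_eq_finrank_selQ_add`). [cite: WZhang2014, Thm. 9.2] -/
theorem stubB_body_of_cruxAt_of_flip_of_oddSelmer_of_cover_of_bottom [W.IsElliptic] [NeZero (W.conductorNorm ℤ)]
    [Module (ZMod 3) (V3 W K)] (hK : IsImaginaryQuadratic K)
    (Dt : ModularParametrizationData W (W.conductorNorm ℤ)) (β : ℤ) (ι : K →+* ℂ)
    (hcrux : ∃ (n : ℕ) (d : KolyvaginHeegnerData Dt β ι n),
      KolyvaginDescent.KolSupp (Zhang2014.IsKolyvaginPrime (W.conductorNorm ℤ) W K 3) n ∧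
        d.kolyvaginClass Nat.prime_three 1 ≠ 0)
    (hflip : ∀ (n : Finset {q // IsUAdmissiblePrime W K q}) (q : {q // IsUAdmissiblePrime W K q}),
      GoodLevel W K (insert q n) → q ∉ n →
      finrank (ZMod 3) (SelQ W K c (insert q n) true) + finrank (ZMod 3) (SelQ W K c (insert q n) false) + 1 =
          finrank (ZMod 3) (SelQ W K c n true) + finrank (ZMod 3) (SelQ W K c n false) ∨
        finrank (ZMod 3) (SelQ W K c (insert q n) true) + finrank (ZMod 3) (SelQ W K c (insert q n) false) =
          finrank (ZMod 3) (SelQ W K c n true) + finrank (ZMod 3) (SelQ W K c n false) + 1)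
    (hodd : Odd (finrank (ZMod 3)
      (AddSubgroup.toZModSubmodule 3 (selmerGroup (W.baseChange K) ((3 ^ 1 : ℕ) : ℤ)))))
    (hcov : ∃ j : {x : (n : ℕ) × KolyvaginHeegnerData Dt β ι n //
          KolyvaginDescent.KolSupp (Zhang2014.IsKolyvaginPrime (W.conductorNorm ℤ) W K 3) x.1} → V3 W K,
      ∀ q : {q // IsUAdmissiblePrime W K q}, ∃ m, ∃ v : HeightOneSpectrum (𝓞 K), ((q : ℕ) : 𝓞 K) ∈ v.asIdeal ∧
        j m ∉ (W.baseChange K).torsionLocalKer (v.adicCompletion K) ((3 ^ 1 : ℕ) : ℤ))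
    (hbot : (∃ m : {x : (n : ℕ) × KolyvaginHeegnerData Dt β ι n //
          KolyvaginDescent.KolSupp (Zhang2014.IsKolyvaginPrime (W.conductorNorm ℤ) W K 3) x.1},
        m.1.2.kolyvaginClass Nat.prime_three 1 ≠ 0) →
      ∃ (s : Bool) (d : ℕ), finrank (ZMod 3) (SelQ W K c ∅ s) = d + 1 ∧
        SelQ W K c ∅ s = SelRelQ W K c ∅ (baseLocusQ W K
          (fun (m : {x : (n : ℕ) × KolyvaginHeegnerData Dt β ι n //
              KolyvaginDescent.KolSupp (Zhang2014.IsKolyvaginPrime (W.conductorNorm ℤ) W K 3) x.1})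
            (_ : Finset {q // IsUAdmissiblePrime W K q}) ↦ m.1.2.kolyvaginClass Nat.prime_three 1) ∅) s ∧
        FiniteDimensional (ZMod 3) (SelRelQ W K c ∅ (baseLocusQ W K
          (fun (m : {x : (n : ℕ) × KolyvaginHeegnerData Dt β ι n //
              KolyvaginDescent.KolSupp (Zhang2014.IsKolyvaginPrime (W.conductorNorm ℤ) W K 3) x.1})
            (_ : Finset {q // IsUAdmissiblePrime W K q}) ↦ m.1.2.kolyvaginClass Nat.prime_three 1) ∅) (!s)) ∧
        finrank (ZMod 3) (SelRelQ W K c ∅ (baseLocusQ W K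
          (fun (m : {x : (n : ℕ) × KolyvaginHeegnerData Dt β ι n //
              KolyvaginDescent.KolSupp (Zhang2014.IsKolyvaginPrime (W.conductorNorm ℤ) W K 3) x.1})
            (_ : Finset {q // IsUAdmissiblePrime W K q}) ↦ m.1.2.kolyvaginClass Nat.prime_three 1) ∅) (!s)) ≤ d) :
    ∃ (κ : {x : (n : ℕ) × KolyvaginHeegnerData Dt β ι n //
            KolyvaginDescent.KolSupp (Zhang2014.IsKolyvaginPrime (W.conductorNorm ℤ) W K 3) x.1} →
          Finset {q // IsUAdmissiblePrime W K q} → V3 W K)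
      (m₁ : {x : (n : ℕ) × KolyvaginHeegnerData Dt β ι n //
            KolyvaginDescent.KolSupp (Zhang2014.IsKolyvaginPrime (W.conductorNorm ℤ) W K 3) x.1}),
      (∀ m, κ m ∅ = m.1.2.kolyvaginClass Nat.prime_three 1) ∧
      (∀ (n : Finset {q // IsUAdmissiblePrime W K q}) (q₁ q₂ : {q // IsUAdmissiblePrime W K q}),
        GoodLevel W K n → GoodLevel W K (insert q₁ n) → GoodLevel W K (insert q₂ (insert q₁ n)) →
        q₁ ∉ n → q₂ ∉ insert q₁ n → q₂ ∉ baseLocusQ W K κ (insert q₂ (insert q₁ n)) → ∃ m, κ m n ≠ 0) ∧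
      (∀ (n : Finset {q // IsUAdmissiblePrime W K q}), GoodLevel W K n → Even n.card → (∃ m, κ m n ≠ 0) →
        ∃ (s : Bool) (d : ℕ), finrank (ZMod 3) (SelQ W K c n s) = d + 1 ∧
          SelQ W K c n s = SelRelQ W K c n (baseLocusQ W K κ n) s ∧
          FiniteDimensional (ZMod 3) (SelRelQ W K c n (baseLocusQ W K κ n) (!s)) ∧
          finrank (ZMod 3) (SelRelQ W K c n (baseLocusQ W K κ n) (!s)) ≤ d) ∧
      (∀ (n : Finset {q // IsUAdmissiblePrime W K q}), GoodLevel W K n → Even n.card →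
        finrank (ZMod 3) (SelQ W K c n true) + finrank (ZMod 3) (SelQ W K c n false) = 1 → κ m₁ n ≠ 0) := by
  have hodd0 : Odd (finrank (ZMod 3) (SelQ W K c ∅ true) + finrank (ZMod 3) (SelQ W K c ∅ false)) := by
    rw [← finrank_selmer_eq_finrank_selQ_add W K hK c (algEquiv_mul_self_eq_one K hK c)]
    exact hodd
  exact stubB_body_of_cruxAt_of_oddRank_of_cover_of_bottom W K c Dt β ι hcrux
    (fun n hg _ hev ↦ odd_selQRank_on_goodLevel_of_flip_of_odd W K c hflip hodd0 n hg hev) hcov hbot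

end Summit.BirchSwinnertonDyer.Rank1Residual.X11b.Three.Koly.Method2

end
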